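import Mathlib
import HarnessLib
import Summits.NavierStokesRegularity.NavierStokesRegularity.Theorems.QuarterLogPincerSmoothSilenceDefs
import Summits.NavierStokesRegularity.NavierStokesRegularity.Theorems.QuarterLogPincerSmoothSilenceNormalisation
import Literature.Analysis.PDE.LoewnerNirenbergFacts

/-!
# Route `QuarterLogPincer`, crux `TypeIQuantSubcubicExp` (stmt-NavierStokesRegularity-24077), line `smooth_silence` —
# L♯2 plan, part P2: NORMALISATION of a raw vanishing witness (`smoothVanishingWitness_of_raw`)

Part P2 of the typed plan `pub-ns-dss/typer/STUB-PLAN-SmoothLimitStep.md` (typer g38, idea-crit-4 SIZE WORD 2026-08-29T08:54Z) for the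
stub L♯2 `SmoothSilence.stub_smoothLimitStep : SmoothLimitStep` of ns-idea-7's line `smooth_silence` (v1.2): the compactness step produces a
RAW backward-vanishing witness on a slab `(0, S) × ℝ³` of span `S ∈ (0, 1]`, with some amplitude bound `A` and some constant `B'`; this file
turns any such raw witness into a `SmoothVanishingWitness` (unit span, amplitude `≤ 1`) by the linear change of variables
`ω♮ s x := A'⁻¹ • ω (S s) (√S x)`, `A' := max 1 A`.  Every clause transports: joint `C¹` and the `C¹₂` clause by composition with the linear map
`(s, x) ↦ (S s, √S x)`; `∂ₛω♮ = (S/A') ∂ₛω`, `Δω♮ = (S/A') Δω`, `Dω♮ = (√S/A') Dω`, `D²ω♮ = (S/A') D²ω`, so the bounds keep the constant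
`B'` (all factors `≤ 1`) and the inequality `|∂ₛω − Δω| ≤ B'(|ω| + |Dω|)` becomes `|∂ₛω♮ − Δω♮| ≤ S B'|ω♮| + √S B'|Dω♮| ≤ B'(|ω♮| + |Dω♮|)`;
`ω♮(1) = 0`, `ω♮(0, x₀/√S) ≠ 0`.

HONEST FRAME: a change-of-variables lemma toward ONE open stub (L♯2) of a line four levels below the crux; it proves nothing about L♯2's
analytic core (parts P1a–P1d of the plan), E2, the crux, W7 or Navier–Stokes regularity (OPEN / not proved).  pub-ns-dss typer (g38),
`--supports stmt-NavierStokesRegularity-24077`.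
-/

noncomputable section

set_option linter.dupNamespace false

namespace Summit.NavierStokesRegularity.NavierStokesRegularity.Cruxes.TypeIQuantSubcubicExp.SmoothSilence

open MeasureTheory Set Function Filter Topology Metric
open scoped ENNReal NNReal Laplacian RealInnerProductSpace
open Literature.Analysis Literature.Analysis.FluidPDE Literature.Analysis.PDE.LoewnerNirenberg

/-- **P2 — normalisation of a raw vanishing witness.**  A field `ω` continuous on `ℝ × ℝ³`, jointly `C¹` with the `C¹₂` clause on the open
slab `(0, S) × ℝ³` (`0 < S ≤ 1`), with `C²` slices, time-differentiable there, bounded by `A`, with `‖Dω‖, ‖∂ₛω‖, ‖D²ω‖ ≤ B'` and the caloric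
inequality `‖∂ₛω − Δω‖ ≤ B'(‖ω‖ + ‖Dω‖)` on the slab, vanishing identically at `s = S` and not identically at `s = 0`, yields a
`SmoothVanishingWitness` (via `ω♮ s x = (max 1 A)⁻¹ • ω (S s) (√S x)`, constant `B'`). -/
theorem smoothVanishingWitness_of_raw {S A B' : ℝ} (hS : 0 < S) (hS1 : S ≤ 1) (hB' : 0 ≤ B')
    {ω : ℝ → EuclideanSpace ℝ (Fin 3) → EuclideanSpace ℝ (Fin 3)}
    (hcont : Continuous (uncurry ω))
    (hC1 : ContDiffOn ℝ 1 (uncurry ω) (Ioo 0 S ×ˢ (univ : Set (EuclideanSpace ℝ (Fin 3)))))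
    (hC12 : ∀ e' : EuclideanSpace ℝ (Fin 3),
      ContDiffOn ℝ 1 (fun z : ℝ × EuclideanSpace ℝ (Fin 3) => fderiv ℝ (ω z.1) z.2 e')
        (Ioo 0 S ×ˢ (univ : Set (EuclideanSpace ℝ (Fin 3)))))
    (hC2 : ∀ s ∈ Ioo 0 S, ContDiff ℝ 2 (ω s))
    (ht : ∀ s ∈ Ioo 0 S, ∀ x : EuclideanSpace ℝ (Fin 3), DifferentiableAt ℝ (fun r => ω r x) s)
    (hsup : ∀ s : ℝ, ∀ x : EuclideanSpace ℝ (Fin 3), ‖ω s x‖ ≤ A)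
    (hbd : ∀ s ∈ Ioo 0 S, ∀ x : EuclideanSpace ℝ (Fin 3),
      ‖fderiv ℝ (ω s) x‖ ≤ B' ∧ ‖timeDeriv ω s x‖ ≤ B' ∧ ‖iteratedFDeriv ℝ 2 (ω s) x‖ ≤ B')
    (hineq : ∀ s ∈ Ioo 0 S, ∀ x : EuclideanSpace ℝ (Fin 3),
      ‖timeDeriv ω s x - (Δ (ω s)) x‖ ≤ B' * (‖ω s x‖ + ‖fderiv ℝ (ω s) x‖))
    (hend : ∀ x : EuclideanSpace ℝ (Fin 3), ω S x = 0) (hstart : ∃ x : EuclideanSpace ℝ (Fin 3), ω 0 x ≠ 0) :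
    SmoothVanishingWitness := by
  -- constants
  set c : ℝ := Real.sqrt S with hc
  have hcpos : 0 < c := Real.sqrt_pos.2 hS
  have hc0 : c ≠ 0 := hcpos.ne'
  have hc1 : c ≤ 1 := by rw [hc]; exact Real.sqrt_le_one.mpr hS1 |>.trans_eq' rfl
  have hcsq : c ^ 2 = S := by rw [hc, Real.sq_sqrt hS.le]
  set A' : ℝ := max 1 A with hA'
  have hA'1 : 1 ≤ A' := le_max_left _ _
  have hA'A : A ≤ A' := le_max_right _ _
  have hA'pos : 0 < A' := lt_of_lt_of_le one_pos hA'1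
  have hA'inv : 0 < A'⁻¹ := inv_pos.2 hA'pos
  have hA'inv1 : A'⁻¹ ≤ 1 := inv_le_one_of_one_le₀ hA'1
  -- the normalised field
  set ωn : ℝ → EuclideanSpace ℝ (Fin 3) → EuclideanSpace ℝ (Fin 3) := fun s x => A'⁻¹ • ω (S * s) (c • x) with hωn
  -- the slab maps to the slab
  have hslab : ∀ {s : ℝ}, s ∈ Ioo (0 : ℝ) 1 → S * s ∈ Ioo 0 S := fun {s} hs =>
    ⟨mul_pos hS hs.1, by nlinarith [hs.2]⟩
  -- the linear change of variables as a smooth map of the space–time plane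
  set Lmap : ℝ × EuclideanSpace ℝ (Fin 3) → ℝ × EuclideanSpace ℝ (Fin 3) := fun z => (S * z.1, c • z.2) with hL
  have hLsmooth : ContDiff ℝ 1 Lmap := by
    rw [hL]
    exact (contDiff_const.mul contDiff_fst).prodMk (contDiff_snd.const_smul c)
  have hLmaps : MapsTo Lmap (Ioo (0 : ℝ) 1 ×ˢ (univ : Set (EuclideanSpace ℝ (Fin 3))))
      (Ioo 0 S ×ˢ (univ : Set (EuclideanSpace ℝ (Fin 3)))) := fun z hz =>
    ⟨hslab (mem_prod.1 hz).1, mem_univ _⟩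
  -- slice derivatives of the normalised field
  have hD : ∀ s ∈ Ioo (0 : ℝ) 1, ∀ x, fderiv ℝ (ωn s) x = (A'⁻¹ * c) • fderiv ℝ (ω (S * s)) (c • x) := by
    intro s hs x
    have hdiff : Differentiable ℝ (fun w => ω (S * s) (c • w)) :=
      ((hC2 _ (hslab hs)).differentiable (by norm_num)).comp (differentiable_id.const_smul c)
    have h1 : ωn s = A'⁻¹ • (fun w => ω (S * s) (c • w)) := rfl
    rw [h1, fderiv_const_smul (hdiff x), fderiv_comp_smul, smul_smul]
  have hD2 : ∀ s x, ‖iteratedFDeriv ℝ 2 (ωn s) x‖ ≤ A'⁻¹ * c ^ 2 * ‖iteratedFDeriv ℝ 2 (ω (S * s)) (c • x)‖ := by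
    intro s x
    have h1 : ωn s = fun w => A'⁻¹ • ω (S * s) ((0 : EuclideanSpace ℝ (Fin 3)) + c • w) := by
      funext w; simp only [hωn, zero_add]
    rw [h1]
    have h := norm_iteratedFDeriv_smul_comp_affine_le (ω (S * s)) A'⁻¹ hc0 0 2 x
    rw [zero_add, abs_of_pos hA'inv, abs_of_pos hcpos] at h
    exact h
  have hT : ∀ s x, timeDeriv ωn s x = (A'⁻¹ * S) • timeDeriv ω (S * s) (c • x) := by
    intro s x
    simp only [timeDeriv_apply]
    have h1 : (fun r => ωn r x) = fun r => A'⁻¹ • (fun r' => ω r' (c • x)) (S * r) := rfl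
    rw [h1, deriv_fun_const_smul_field]
    have h2 := deriv_comp_mul_left (f := fun r' => ω r' (c • x)) (c := S) (x := s)
    rw [h2, smul_smul]
  have hLap : ∀ s x, (Δ (ωn s)) x = (A'⁻¹ * c ^ 2) • (Δ (ω (S * s))) (c • x) := by
    intro s x
    have h1 : ωn s = fun w => A'⁻¹ • ω (S * s) (c • w) := rfl
    rw [h1, laplacian_const_smul_comp_smul']
  refine ⟨B', ωn, hB', ?_, ?_, ?_, ?_, ?_, ?_, ?_, ?_, ?_, ?_⟩
  · -- continuity
    have h : uncurry ωn = fun z => A'⁻¹ • uncurry ω (Lmap z) := by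
      funext z; rfl
    rw [h]
    have h2 : Continuous fun z : ℝ × EuclideanSpace ℝ (Fin 3) => uncurry ω (Lmap z) := hcont.comp hLsmooth.continuous
    exact h2.const_smul A'⁻¹
  · -- joint C¹ on the slab
    have h : uncurry ωn = fun z => A'⁻¹ • uncurry ω (Lmap z) := by
      funext z; rfl
    rw [h]
    have h2 : ContDiffOn ℝ 1 (fun z : ℝ × EuclideanSpace ℝ (Fin 3) => uncurry ω (Lmap z))
        (Ioo (0 : ℝ) 1 ×ˢ (univ : Set (EuclideanSpace ℝ (Fin 3)))) := hC1.comp hLsmooth.contDiffOn hLmaps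
    exact h2.const_smul A'⁻¹
  · -- the C¹₂ clause
    intro e'
    have h2 : ContDiffOn ℝ 1 (fun z : ℝ × EuclideanSpace ℝ (Fin 3) =>
        (A'⁻¹ * c) • (fun w : ℝ × EuclideanSpace ℝ (Fin 3) => fderiv ℝ (ω w.1) w.2 e') (Lmap z))
        (Ioo (0 : ℝ) 1 ×ˢ (univ : Set (EuclideanSpace ℝ (Fin 3)))) :=
      ((hC12 e').comp hLsmooth.contDiffOn hLmaps).const_smul (A'⁻¹ * c)
    refine h2.congr fun z hz => ?_
    have hz1 : z.1 ∈ Ioo (0 : ℝ) 1 := (mem_prod.1 hz).1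
    rw [hD z.1 hz1 z.2]
    rfl
  · -- C² slices
    intro s hs
    have h1 : ωn s = fun w => A'⁻¹ • ω (S * s) (c • w) := rfl
    rw [h1]
    exact ((hC2 _ (hslab hs)).comp (contDiff_const_smul c)).const_smul _
  · -- time differentiability
    intro s hs x
    have h1 : (fun r => ωn r x) = fun r => A'⁻¹ • ((fun r' => ω r' (c • x)) ∘ (fun r => S * r)) r := rfl
    rw [h1]
    have h2 : DifferentiableAt ℝ ((fun r' => ω r' (c • x)) ∘ fun r => S * r) s :=
      (ht _ (hslab hs) (c • x)).comp s ((differentiableAt_const _).mul differentiableAt_id)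
    exact h2.const_smul A'⁻¹
  · -- amplitude ≤ 1
    intro s x
    rw [show ωn s x = A'⁻¹ • ω (S * s) (c • x) from rfl, norm_smul, Real.norm_of_nonneg hA'inv.le]
    calc A'⁻¹ * ‖ω (S * s) (c • x)‖ ≤ A'⁻¹ * A' :=
          mul_le_mul_of_nonneg_left ((hsup _ _).trans hA'A) hA'inv.le
      _ = 1 := inv_mul_cancel₀ hA'pos.ne'
  · -- the three bounds
    intro s hs x
    obtain ⟨b1, b2, b3⟩ := hbd _ (hslab hs) (c • x)
    refine ⟨?_, ?_, ?_⟩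
    · rw [hD s hs x, norm_smul, Real.norm_of_nonneg (by positivity)]
      calc A'⁻¹ * c * ‖fderiv ℝ (ω (S * s)) (c • x)‖ ≤ 1 * 1 * B' := by gcongr
        _ = B' := by ring
    · rw [hT, norm_smul, Real.norm_of_nonneg (by positivity)]
      calc A'⁻¹ * S * ‖timeDeriv ω (S * s) (c • x)‖ ≤ 1 * 1 * B' := by gcongr
        _ = B' := by ring
    · calc ‖iteratedFDeriv ℝ 2 (ωn s) x‖ ≤ A'⁻¹ * c ^ 2 * ‖iteratedFDeriv ℝ 2 (ω (S * s)) (c • x)‖ := hD2 s x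
        _ ≤ 1 * 1 * B' := by
            gcongr
            · calc c ^ 2 = S := hcsq
                _ ≤ 1 := hS1
        _ = B' := by ring
  · -- the inequality
    intro s hs x
    have h := hineq _ (hslab hs) (c • x)
    have e1 : ‖timeDeriv ωn s x - (Δ (ωn s)) x‖ =
        A'⁻¹ * S * ‖timeDeriv ω (S * s) (c • x) - (Δ (ω (S * s))) (c • x)‖ := by
      rw [hT, hLap, hcsq, ← smul_sub, norm_smul, Real.norm_of_nonneg (by positivity)]
    have e2 : ‖ωn s x‖ = A'⁻¹ * ‖ω (S * s) (c • x)‖ := by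
      rw [show ωn s x = A'⁻¹ • ω (S * s) (c • x) from rfl, norm_smul, Real.norm_of_nonneg hA'inv.le]
    have e3 : ‖fderiv ℝ (ωn s) x‖ = A'⁻¹ * c * ‖fderiv ℝ (ω (S * s)) (c • x)‖ := by
      rw [hD s hs x, norm_smul, Real.norm_of_nonneg (by positivity)]
    rw [e1, e2, e3]
    -- `(S/A') B'(‖ω‖ + ‖Dω‖) ≤ B'(A'⁻¹‖ω‖ + A'⁻¹ c ‖Dω‖)` since `S ≤ 1`, `S ≤ c`
    have hSc : S ≤ c := by
      calc S = c ^ 2 := hcsq.symm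
        _ = c * c := sq c
        _ ≤ 1 * c := mul_le_mul_of_nonneg_right hc1 hcpos.le
        _ = c := one_mul c
    have hω0 : 0 ≤ ‖ω (S * s) (c • x)‖ := norm_nonneg _
    have hDω0 : 0 ≤ ‖fderiv ℝ (ω (S * s)) (c • x)‖ := norm_nonneg _
    calc A'⁻¹ * S * ‖timeDeriv ω (S * s) (c • x) - Δ (ω (S * s)) (c • x)‖
        ≤ A'⁻¹ * S * (B' * (‖ω (S * s) (c • x)‖ + ‖fderiv ℝ (ω (S * s)) (c • x)‖)) :=
          mul_le_mul_of_nonneg_left h (by positivity)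
      _ = B' * (S * (A'⁻¹ * ‖ω (S * s) (c • x)‖) + S * (A'⁻¹ * ‖fderiv ℝ (ω (S * s)) (c • x)‖)) := by ring
      _ ≤ B' * (1 * (A'⁻¹ * ‖ω (S * s) (c • x)‖) + c * (A'⁻¹ * ‖fderiv ℝ (ω (S * s)) (c • x)‖)) := by
          gcongr
      _ = B' * (A'⁻¹ * ‖ω (S * s) (c • x)‖ + A'⁻¹ * c * ‖fderiv ℝ (ω (S * s)) (c • x)‖) := by ring
  · -- vanishing at the end time
    intro x
    rw [show ωn 1 x = A'⁻¹ • ω (S * 1) (c • x) from rfl, mul_one, hend, smul_zero]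
  · -- non-vanishing at time 0
    obtain ⟨x₀, hx₀⟩ := hstart
    refine ⟨c⁻¹ • x₀, ?_⟩
    rw [show ωn 0 (c⁻¹ • x₀) = A'⁻¹ • ω (S * 0) (c • c⁻¹ • x₀) from rfl, mul_zero, smul_smul,
      mul_inv_cancel₀ hc0, one_smul]
    exact smul_ne_zero hA'inv.ne' hx₀

end Summit.NavierStokesRegularity.NavierStokesRegularity.Cruxes.TypeIQuantSubcubicExp.SmoothSilence

end
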